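import Literature.Probability.LatticeModels.DobrushinUniquenessSummablePotential
import Literature.Probability.LatticeModels.DobrushinMetricWeightedDecay
import HarnessLib

/-!
# Dobrushin's condition in the finite-range (Vasserstein-structure) form for the Gibbs
# specification of a bounded finite-range potential (Simon 1979 / Georgii Prop. 8.8 /
# Friedli–Velenik Thm. 6.35), and the covariance decay it feeds

[topic Probability/LatticeModels]

The tree's Dobrushin machinery in the Vasserstein form (`DobrushinMetricStates.lean`,
`DobrushinMetricWeightedDecay.lean`, `DobrushinComparisonDefectStates.lean`) takes as input an
instance of `DobrushinMetric.IsKRContraction γ r nbr C`: finite range (`γ_x(· | η)` sees `η` only on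
the finite set `nbr x`) and a one-site contraction estimate with coefficients `C x y`; it returns
comparison, uniqueness and COVARIANCE DECAY with explicit profiles.  Every constructor of that
structure in the tree so far is model-specific (Wilson lattice gauge theory, torus plaquette
weights, slabs, perturbed Yang–Mills).  The companion file
`DobrushinUniquenessSummablePotential.lean` proves, for the Gibbsian specification
`gibbsSpecOfSummablePotential ν Φ β` of an adapted potential with majorant `|Φ_B| ≤ b B`, the
SITEWISE LEGS (exponential `½ (e^{4|β| D_{xy}} − 1)`, linear `|β| D_{xy}`, oscillation
`½ |β| ∑_{B ∋ x,y} δ(Φ_B)`) and the infinite-range UNIQUENESS theorems.  This file supplies the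
missing GENERIC constructor: when the RANGE of the majorant through every site `x` is covered by a
prescribed finite neighbourhood, `B ∋ x, b B ≠ 0 ⟹ B ⊆ {x} ∪ nbr x`, those legs ARE an
`IsKRContraction` for the discrete (total-variation) weight `r ≡ 1`, so the decay theorems apply
verbatim:

* `DobrushinMetric.IsKRContraction.of_tv` — bookkeeping: a finite-range one-site law with a
  total-variation sitewise leg `|γ_x(φ|ω) − γ_x(φ|η)| ≤ C x y · osc φ` (`ω = η` off `y`) IS an
  `IsKRContraction` for the weight `r ≡ 1` (Föllmer 1988, Ch. I, Remark (2.17): the discrete metric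
  recovers the total-variation theory).
* `hamiltonianTsum_singleton_congr_of_range`, `siteLaw_gibbsSpecOfSummablePotential_congr` —
  finite range: the interaction through `x`, hence the one-site law at `x`, depends on the
  boundary condition only on `nbr x` (Georgii 2011, (2.11)–(2.12); Friedli–Velenik 2017, §6.3.2).
* `isKRContraction_gibbsSpecOfSummablePotential_exp` — the instance with Georgii's exponential
  coefficients `C x y = ½ (e^{4|β| D x y} − 1)`, `D x y = ∑_{B ∋ x, y} b B` (leg
  `abs_integral_siteLaw_sub_le_of_eq_off`, Georgii 2011, Prop. 8.8).
* `isKRContraction_gibbsSpecOfSummablePotential` — the instance with SIMON'S LINEAR coefficients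
  `C x y = |β| D x y` (leg `abs_integral_siteLaw_sub_le_of_eq_off_linear`; Simon 1979, Theorem with
  the Lemma p. 184; Friedli–Velenik 2017, Thm. 6.35 with `δ(Φ_B) ≤ 2 ‖Φ_B‖_∞`).
* `isKRContraction_gibbsSpecOfSummablePotential_osc` — the instance with the OSCILLATION
  coefficients `C x y = ½ |β| ∑_{B ∋ x, y} δ B` for oscillation majorants `δ B ≤ 2 b B` (leg
  `abs_integral_siteLaw_sub_le_of_eq_off_osc`; Friedli–Velenik 2017, (6.46) verbatim).
* `pairBound_eq_sum`, `sum_nbr_pairBound_eq` — for a majorant supported on a finite family `T`,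
  `D x y` is a finite sum and the ROW SUM over the neighbourhood is Friedli–Velenik's (6.47):
  `∑_{y ∈ nbr x} D x y = ∑_{B ∈ T, B ∋ x} (|B| − 1) b B` (finite-support twin of the companion
  file's `hasSum_pairMajorant_eq_card_sub_one`), so Dobrushin's constant in Simon's form is
  `|β| sup_x ∑_{B ∋ x} (|B| − 1) ‖Φ_B‖_∞` (Friedli–Velenik 2017, Cor. 6.37; Simon 1979, Theorem).
* `abs_covariance_le_of_finiteRange`, `abs_covariance_le_of_finiteRange_exp_dist` — the
  covariance estimates of Föllmer (1988, Ch. I, Thm. (2.13) and (2.23)–(2.24)) for any Gibbs measure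
  of the specification under `sup_x ∑_{y ∈ nbr x} |β| D x y ≤ c ≤ 1` (profile form) resp. the
  weighted row condition `∑_{y ∈ nbr x} |β| D x y e^{t d x y} ≤ c < 1` (exponential clustering
  `≤ 2 (∑δg)(∑δf) e^{−t m}`), obtained by feeding the linear instance to
  `DobrushinMetric.abs_covariance_le_of_isKRContraction` / `…_exp_dist`.
* `isKRContraction_gibbsSpecOfPotential`, `sum_nbr_pairSum_eq`,
  `abs_covariance_le_of_finSupp_exp_dist`, `subsingleton_gibbsMeasures_gibbsSpecOfPotential_simon` —
  the same constructor, row sums, exponential clustering and Simon's uniqueness theorem stated for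
  the tree's PRIMARY finite-range specification `gibbsSpecOfPotential ν Φ supp β` of a potential with
  `|Φ_B| ≤ C B`, `Φ_B = 0` off a finite family `T`, `Potential.IsSupportedBy Φ supp`, with the FINITE
  pair sums `|β| ∑_{B ∈ T, B ∋ x, y} C B` (transport along
  `gibbsSpecOfSummablePotential_eq_gibbsSpecOfPotential` and `Potential.hasSummableBound_of_finite`;
  Georgii 2011, (2.11)), so that users of `gibbsSpecOfPotential` need no re-expression step.

Scope (honest label): the a priori measure `ν` is any probability measure on any measurable spin
space `S` (compact groups with Haar measure included); `V` countable; `β` real; the neighbourhoods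
`nbr x` are data (any finite sets covering the range; they need not be minimal or symmetric).

## References
* B. Simon, *A remark on Dobrushin's uniqueness theorem*, Commun. Math. Phys. 68 (1979) 183–185,
  Lemma p. 184 and Theorem.
* H.-O. Georgii, *Gibbs Measures and Phase Transitions*, 2nd ed., de Gruyter (2011), Prop. 8.8,
  (2.11)–(2.12).
* S. Friedli, Y. Velenik, *Statistical Mechanics of Lattice Systems*, CUP (2017), Thm. 6.35 with
  (6.46), (6.47), Cor. 6.37 (pp. 293–294); §6.3.2 (range of a potential).
* H. Föllmer, *Random fields and diffusion processes*, LNM 1362 (1988), Ch. I, (2.20), Thm. (2.13),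
  Remark (2.17).
-/

noncomputable section

open MeasureTheory Finset Function

namespace Literature.Probability.LatticeModels

variable {V S : Type*} [DecidableEq V] [MeasurableSpace S]

/-! ### Bookkeeping: a total-variation sitewise leg is a KR contraction for the discrete weight -/

namespace DobrushinMetric

omit [DecidableEq V] in
/-- **A finite-range one-site law with a total-variation sitewise leg is a Dobrushin contraction
for the discrete weight `r ≡ 1`** (Föllmer 1988, Ch. I, Remark (2.17): with the discrete metric
the Vasserstein coefficients (2.20) are the total-variation coefficients of Dobrushin 1968): if
`γ_x(· | η)` depends on `η` only through `nbr x ∌ x`, `C ≥ 0`, and for `ω = η` off `y ∈ nbr x`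
every bounded measurable `φ` of oscillation `≤ L` has `|γ_x(φ | ω) − γ_x(φ | η)| ≤ C x y · L`, then
`IsKRContraction γ 1 nbr C`. [cite: Follmer1988, Ch. I Remark (2.17)] -/
theorem IsKRContraction.of_tv {γ : Specification V S} {nbr : V → Finset V} {C : V → V → ℝ}
    (hnot : ∀ x, x ∉ nbr x) (hC : ∀ x y, 0 ≤ C x y)
    (hcongr : ∀ (x : V) (η η' : V → S), (∀ z ∈ nbr x, η z = η' z) →
      siteLaw γ x η = siteLaw γ x η')
    (hleg : ∀ (x : V), ∀ y ∈ nbr x, ∀ (ω η : V → S), (∀ z, z ≠ y → ω z = η z) →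
      ∀ (φ : S → ℝ) (L : ℝ), Measurable φ → (∃ M, ∀ s, |φ s| ≤ M) →
        (∀ a b, |φ a - φ b| ≤ L) →
          |(∫ s, φ s ∂(siteLaw γ x ω)) - ∫ s, φ s ∂(siteLaw γ x η)| ≤ C x y * L) :
    IsKRContraction γ (fun _ _ => (1 : ℝ)) nbr C :=
  ⟨hnot, hC, hcongr, fun x y hy ω η hωη φ L hφm hφb _hL hφL => by
    rw [mul_one]
    exact hleg x y hy ω η hωη φ L hφm hφb fun a b => by simpa using hφL a b⟩

end DobrushinMetric

/-! ### Finite range: the one-site law sees the boundary condition only on `nbr x` -/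

section FiniteRange

variable {Φ : Potential V S} {b : Finset V → ℝ} {nbr : V → Finset V}

/-- **Finite range, interaction through a site** (Georgii 2011, (2.11)–(2.12); Friedli–Velenik 2017,
§6.3.2): if every `B ∋ x` carrying a nonzero majorant lies in `{x} ∪ nbr x`, then the interaction
through `x`, `H_{x}(σ) = ∑_{B ∋ x} Φ_B(σ)`, depends on `σ` only on `{x} ∪ nbr x`.
[cite: Georgii2011, eq. (2.11)] -/
theorem hamiltonianTsum_singleton_congr_of_range (hΦ : Φ.IsAdapted) (hb : Φ.HasSummableBound b)
    (hrange : ∀ B : Finset V, b B ≠ 0 → ∀ x ∈ B, ∀ z ∈ B, z ≠ x → z ∈ nbr x) (x : V)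
    {σ σ' : V → S} (hx : σ x = σ' x) (hnbr : ∀ z ∈ nbr x, σ z = σ' z) :
    hamiltonianTsum Φ {x} σ = hamiltonianTsum Φ {x} σ' := by
  unfold hamiltonianTsum
  refine tsum_congr fun B => ?_
  by_cases hxB : (B ∩ {x}).Nonempty
  · rw [if_pos hxB, if_pos hxB]
    have hxB' : x ∈ B := by
      obtain ⟨i, hi⟩ := hxB
      rw [Finset.mem_inter, Finset.mem_singleton] at hi
      exact hi.2 ▸ hi.1
    by_cases hbB : b B = 0
    · have h1 : Φ B σ = 0 := abs_nonpos_iff.1 (hbB ▸ hb.abs_le B σ)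
      have h2 : Φ B σ' = 0 := abs_nonpos_iff.1 (hbB ▸ hb.abs_le B σ')
      rw [h1, h2]
    · refine (hΦ B).1 fun i hi => ?_
      by_cases hix : i = x
      · subst hix; exact hx
      · exact hnbr i (hrange B hbB x hxB' i (Finset.mem_coe.1 hi) hix)
  · rw [if_neg hxB, if_neg hxB]

/-- **Finite range, one-site law** (Georgii 2011, (2.11)–(2.12) with Def. 2.9; Föllmer 1988, Ch. I,
(2.20): "finite range"): under the range hypothesis and `x ∉ nbr x`, boundary conditions that agree
on `nbr x` have the same one-site law at `x` under `gibbsSpecOfSummablePotential ν Φ β`.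
[cite: Georgii2011, eq. (2.11)] -/
theorem siteLaw_gibbsSpecOfSummablePotential_congr [Countable V] (ν : Measure S)
    [IsProbabilityMeasure ν] (hΦ : Φ.IsAdapted) (hb : Φ.HasSummableBound b) (β : ℝ)
    (hnot : ∀ x, x ∉ nbr x)
    (hrange : ∀ B : Finset V, b B ≠ 0 → ∀ x ∈ B, ∀ z ∈ B, z ≠ x → z ∈ nbr x) (x : V)
    {η η' : V → S} (hη : ∀ z ∈ nbr x, η z = η' z) :
    DobrushinMetric.siteLaw (gibbsSpecOfSummablePotential ν Φ β) x η =
      DobrushinMetric.siteLaw (gibbsSpecOfSummablePotential ν Φ β) x η' := by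
  rw [siteLaw_gibbsSpecOfSummablePotential ν hΦ hb β x η,
    siteLaw_gibbsSpecOfSummablePotential ν hΦ hb β x η']
  congr 1
  funext s
  rw [hamiltonianTsum_singleton_congr_of_range hΦ hb hrange x (σ := Function.update η x s)
    (σ' := Function.update η' x s) (by simp) fun z hz => ?_]
  have hzx : z ≠ x := fun h => hnot x (h ▸ hz)
  rw [Function.update_of_ne hzx, Function.update_of_ne hzx, hη z hz]

/-! ### The instance with Georgii's exponential coefficients -/

/-- **Dobrushin's condition, exponential form** (Georgii 2011, Prop. 8.8): for the Gibbsian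
specification of an adapted potential with majorant `b` of finite range `nbr`,
`IsKRContraction γ 1 nbr C` with `C x y = ½ (e^{4|β| D x y} − 1)`, `D x y = ∑_{B ∋ x, y} b B` —
the tree's sitewise leg `abs_integral_siteLaw_sub_le_of_eq_off` packaged for the Vasserstein
machinery. [cite: Georgii2011, Prop. 8.8] -/
theorem isKRContraction_gibbsSpecOfSummablePotential_exp [Countable V] (ν : Measure S)
    [IsProbabilityMeasure ν] (hΦ : Φ.IsAdapted) (hb : Φ.HasSummableBound b) (β : ℝ)
    (hnot : ∀ x, x ∉ nbr x)
    (hrange : ∀ B : Finset V, b B ≠ 0 → ∀ x ∈ B, ∀ z ∈ B, z ≠ x → z ∈ nbr x) :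
    DobrushinMetric.IsKRContraction (gibbsSpecOfSummablePotential ν Φ β) (fun _ _ => (1 : ℝ)) nbr
      fun x y => (Real.exp (2 * (2 * |β| * ∑' B : Finset V, if x ∈ B ∧ y ∈ B then b B else 0)) - 1)
        / 2 := by
  obtain ⟨s₀, -⟩ : (Set.univ : Set S).Nonempty :=
    nonempty_of_measure_ne_zero (μ := ν) (by rw [measure_univ]; exact one_ne_zero)
  haveI : Nonempty (V → S) := ⟨fun _ => s₀⟩
  refine DobrushinMetric.IsKRContraction.of_tv hnot (fun x y => ?_)
    (fun x η η' hη => siteLaw_gibbsSpecOfSummablePotential_congr ν hΦ hb β hnot hrange x hη)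
    fun x y _hy ω η hωη φ L hφm hφb hφL =>
      abs_integral_siteLaw_sub_le_of_eq_off ν hΦ hb β x y hωη hφm hφb hφL
  have hD : 0 ≤ ∑' B : Finset V, (if x ∈ B ∧ y ∈ B then b B else 0) :=
    tsum_nonneg fun B => by
      split_ifs
      exacts [hb.nonneg B, le_rfl]
  have : 0 ≤ Real.exp (2 * (2 * |β| * ∑' B : Finset V, if x ∈ B ∧ y ∈ B then b B else 0)) - 1 :=
    sub_nonneg.2 (Real.one_le_exp (by positivity))
  positivity

/-! ### The instance with Simon's linear coefficients -/

/-- **Dobrushin's condition in Simon's linear form** (Simon 1979, Theorem with the Lemma p. 184;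
Friedli–Velenik 2017, Thm. 6.35 / (6.46) with `δ(Φ_B) ≤ 2‖Φ_B‖_∞`; Georgii 2011, Prop. 8.8): for
the Gibbsian specification of an adapted potential with majorant `b` of finite range `nbr`,
`IsKRContraction γ 1 nbr C` with the LINEAR coefficients `C x y = |β| D x y`,
`D x y = ∑_{B ∋ x, y} b B` (sitewise leg `abs_integral_siteLaw_sub_le_of_eq_off_linear` of the
companion file).  With `sum_nbr_pairBound_eq` the row sums are `|β| ∑_{B ∋ x} (|B| − 1) b B`.
[cite: FriedliVelenik2017, Thm. 6.35] -/
theorem isKRContraction_gibbsSpecOfSummablePotential [Countable V] (ν : Measure S)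
    [IsProbabilityMeasure ν] (hΦ : Φ.IsAdapted) (hb : Φ.HasSummableBound b) (β : ℝ)
    (hnot : ∀ x, x ∉ nbr x)
    (hrange : ∀ B : Finset V, b B ≠ 0 → ∀ x ∈ B, ∀ z ∈ B, z ≠ x → z ∈ nbr x) :
    DobrushinMetric.IsKRContraction (gibbsSpecOfSummablePotential ν Φ β) (fun _ _ => (1 : ℝ)) nbr
      fun x y => |β| * ∑' B : Finset V, if x ∈ B ∧ y ∈ B then b B else 0 := by
  obtain ⟨s₀, -⟩ : (Set.univ : Set S).Nonempty :=
    nonempty_of_measure_ne_zero (μ := ν) (by rw [measure_univ]; exact one_ne_zero)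
  haveI : Nonempty (V → S) := ⟨fun _ => s₀⟩
  refine DobrushinMetric.IsKRContraction.of_tv hnot (fun x y => ?_)
    (fun x η η' hη => siteLaw_gibbsSpecOfSummablePotential_congr ν hΦ hb β hnot hrange x hη)
    fun x y _hy ω η hωη φ L hφm hφb hφL => ?_
  · exact mul_nonneg (abs_nonneg β) (tsum_nonneg fun B => by
      split_ifs
      exacts [hb.nonneg B, le_rfl])
  · exact abs_integral_siteLaw_sub_le_of_eq_off_linear ν hΦ hb β x y hωη hφm hφb hφL

/-! ### The instance with oscillation coefficients (Friedli–Velenik (6.46) verbatim) -/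

/-- **Dobrushin's condition with oscillation coefficients** (Friedli–Velenik 2017, Thm. 6.35 /
(6.46): `sup_i ∑_{j ≠ i} ∑_{B ⊃ {i,j}} δ(Φ_B) < 1`, whose sitewise form carries the factor `½` of
Simon's lemma; Simon 1979, Remarks 1–2 p. 185): for oscillation majorants `|Φ_B σ − Φ_B σ'| ≤ δ B`
with `δ B ≤ 2 b B`, `IsKRContraction γ 1 nbr C` with `C x y = ½ |β| ∑_{B ∋ x, y} δ B` (sitewise leg
`abs_integral_siteLaw_sub_le_of_eq_off_osc` of the companion file).
[cite: FriedliVelenik2017, Thm. 6.35 eq. (6.46)] -/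
theorem isKRContraction_gibbsSpecOfSummablePotential_osc [Countable V] (ν : Measure S)
    [IsProbabilityMeasure ν] (hΦ : Φ.IsAdapted) (hb : Φ.HasSummableBound b)
    {δ : Finset V → ℝ} (hδ : ∀ B σ σ', |Φ B σ - Φ B σ'| ≤ δ B) (hδb : ∀ B, δ B ≤ 2 * b B) (β : ℝ)
    (hnot : ∀ x, x ∉ nbr x)
    (hrange : ∀ B : Finset V, b B ≠ 0 → ∀ x ∈ B, ∀ z ∈ B, z ≠ x → z ∈ nbr x) :
    DobrushinMetric.IsKRContraction (gibbsSpecOfSummablePotential ν Φ β) (fun _ _ => (1 : ℝ)) nbr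
      fun x y => |β| / 2 * ∑' B : Finset V, if x ∈ B ∧ y ∈ B then δ B else 0 := by
  obtain ⟨s₀, -⟩ : (Set.univ : Set S).Nonempty :=
    nonempty_of_measure_ne_zero (μ := ν) (by rw [measure_univ]; exact one_ne_zero)
  haveI : Nonempty (V → S) := ⟨fun _ => s₀⟩
  have hδ0 : ∀ B, 0 ≤ δ B := fun B => (abs_nonneg _).trans (hδ B (fun _ => s₀) fun _ => s₀)
  refine DobrushinMetric.IsKRContraction.of_tv hnot (fun x y => ?_)
    (fun x η η' hη => siteLaw_gibbsSpecOfSummablePotential_congr ν hΦ hb β hnot hrange x hη)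
    fun x y _hy ω η hωη φ L hφm hφb hφL => ?_
  · exact mul_nonneg (div_nonneg (abs_nonneg β) zero_le_two) (tsum_nonneg fun B => by
      split_ifs
      exacts [hδ0 B, le_rfl])
  · exact abs_integral_siteLaw_sub_le_of_eq_off_osc ν hΦ hb hδ hδb β x y hωη hφm hφb hφL

/-! ### Row sums for a finitely supported majorant (Friedli–Velenik (6.47)) -/

omit [MeasurableSpace S] in
/-- For a majorant vanishing off the finite family `T`, the pair bound is a finite sum:
`D x y = ∑_{B ∈ T, B ∋ x, y} b B`. [cite: FriedliVelenik2017, eq. (6.46)] -/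
theorem pairBound_eq_sum {T : Finset (Finset V)} (hT : ∀ B ∉ T, b B = 0) (x y : V) :
    (∑' B : Finset V, if x ∈ B ∧ y ∈ B then b B else 0) =
      ∑ B ∈ T, if x ∈ B ∧ y ∈ B then b B else 0 := by
  refine tsum_eq_sum fun B hB => ?_
  simp [hT B hB]

omit [MeasurableSpace S] in
/-- **Row sums, Friedli–Velenik (6.47)**: `∑_{y ≠ x} ∑_{B ⊃ {x, y}} b B = ∑_{B ∋ x} (|B| − 1) b B`;
here with the neighbourhood `nbr x ∌ x` covering the range (`B ∋ x, b B ≠ 0 ⟹ B ⊆ {x} ∪ nbr x`):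
`∑_{y ∈ nbr x} D x y = ∑_{B ∈ T, B ∋ x} (|B| − 1) b B` (finite-support twin of the companion file's
`hasSum_pairMajorant_eq_card_sub_one`).  Hence Dobrushin's constant in Simon's form is
`|β| sup_x ∑_{B ∋ x} (|B| − 1) b B` (Friedli–Velenik 2017, Cor. 6.37; Simon 1979, Theorem).
[cite: FriedliVelenik2017, eq. (6.47)] -/
theorem sum_nbr_pairBound_eq {T : Finset (Finset V)} (hT : ∀ B ∉ T, b B = 0)
    (hnot : ∀ x, x ∉ nbr x)
    (hrange : ∀ B : Finset V, b B ≠ 0 → ∀ x ∈ B, ∀ z ∈ B, z ≠ x → z ∈ nbr x) (x : V) :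
    ∑ y ∈ nbr x, (∑' B : Finset V, if x ∈ B ∧ y ∈ B then b B else 0) =
      ∑ B ∈ T, if x ∈ B then ((B.card : ℝ) - 1) * b B else 0 := by
  simp_rw [pairBound_eq_sum hT]
  rw [Finset.sum_comm]
  refine Finset.sum_congr rfl fun B _ => ?_
  by_cases hxB : x ∈ B
  · rw [if_pos hxB]
    by_cases hbB : b B = 0
    · simp [hbB]
    · have hfilter : (nbr x).filter (fun y => y ∈ B) = B.erase x := by
        ext y
        simp only [Finset.mem_filter, Finset.mem_erase]
        constructor
        · rintro ⟨hy, hyB⟩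
          exact ⟨fun h => hnot x (h ▸ hy), hyB⟩
        · rintro ⟨hyx, hyB⟩
          exact ⟨hrange B hbB x hxB y hyB hyx, hyB⟩
      calc ∑ y ∈ nbr x, (if x ∈ B ∧ y ∈ B then b B else 0)
          = ∑ y ∈ nbr x, (if y ∈ B then b B else 0) := by
            refine Finset.sum_congr rfl fun y _ => ?_
            simp [hxB]
        _ = ∑ y ∈ (nbr x).filter (fun y => y ∈ B), b B := by rw [Finset.sum_filter]
        _ = ((B.card : ℝ) - 1) * b B := by
            rw [Finset.sum_const, hfilter, Finset.card_erase_of_mem hxB, nsmul_eq_mul,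
              Nat.cast_sub (Finset.card_pos.2 ⟨x, hxB⟩), Nat.cast_one]
  · rw [if_neg hxB]
    exact Finset.sum_eq_zero fun y _ => by simp [hxB]

/-! ### Covariance decay for the Gibbs measures of a finite-range potential -/

/-- **Föllmer's covariance estimate for a finite-range potential** (Föllmer 1988, Ch. I,
Thm. (2.13) in the form of Remark (2.17); Simon 1979; Georgii 2011, §8.2): with Simon's linear
coefficients `C x y = |β| D x y` and row sums `∑_{y ∈ nbr x} C x y ≤ c ≤ 1`, every Gibbs measure `μ`
of `gibbsSpecOfSummablePotential ν Φ β` satisfies, for bounded measurable local `f, g` with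
oscillation vectors `δf, δg` and every profile `ℓ` vanishing on the dependence set of `g` and
`1`-Lipschitz along `nbr`, `|cov_μ(f, g)| ≤ 2 (∑ δg) ∑_{y ∈ Δ_f} c^{ℓ y} δf y` — the tree's
`DobrushinMetric.abs_covariance_le_of_isKRContraction` fed with
`isKRContraction_gibbsSpecOfSummablePotential` (weight `r ≡ 1`, `R = 1`).
[cite: Follmer1988, Ch. I Theorem (2.13)] -/
theorem abs_covariance_le_of_finiteRange [Countable V] [MeasurableSingletonClass S]
    (ν : Measure S) [IsProbabilityMeasure ν] (hΦ : Φ.IsAdapted) (hb : Φ.HasSummableBound b)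
    (β : ℝ) (hnot : ∀ x, x ∉ nbr x)
    (hrange : ∀ B : Finset V, b B ≠ 0 → ∀ x ∈ B, ∀ z ∈ B, z ≠ x → z ∈ nbr x)
    {c : ℝ} (hc0 : 0 ≤ c) (hc1 : c ≤ 1)
    (hrow : ∀ x, ∑ y ∈ nbr x, |β| * (∑' B : Finset V, if x ∈ B ∧ y ∈ B then b B else 0) ≤ c)
    {μ : Measure (V → S)} (hμ : IsGibbsMeasure (gibbsSpecOfSummablePotential ν Φ β) μ)
    {f g : (V → S) → ℝ} (hfm : Measurable f) {Δf : Finset V} (hfdep : DependsOn f (↑Δf : Set V))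
    {Mf : ℝ} (hMf : ∀ σ, |f σ| ≤ Mf) {δf : V → ℝ}
    (hδf : DobrushinMetric.IsLipBound (fun _ _ => (1 : ℝ)) f δf)
    (hgm : Measurable g) {Δg : Finset V} (hgdep : DependsOn g (↑Δg : Set V)) {Mg : ℝ}
    (hMg : ∀ σ, |g σ| ≤ Mg) {δg : V → ℝ} (hδg : DobrushinMetric.IsLipBound (fun _ _ => (1 : ℝ)) g δg)
    (ℓ : V → ℕ) (hℓ0 : ∀ y ∈ Δg, ℓ y = 0) (hℓ : ∀ x ∉ Δg, ∀ y ∈ nbr x, ℓ x ≤ ℓ y + 1) :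
    |ProbabilityTheory.covariance f g μ| ≤
      2 * (∑ y ∈ Δg, δg y) * ∑ y ∈ Δf, c ^ ℓ y * δf y := by
  have h := DobrushinMetric.abs_covariance_le_of_isKRContraction
    (isSpecification_gibbsSpecOfSummablePotential ν hΦ hb β)
    (isKRContraction_gibbsSpecOfSummablePotential ν hΦ hb β hnot hrange) (R := 1)
    (fun _ _ => zero_le_one) (fun _ _ => le_rfl) zero_le_one hc0 hc1 hrow hμ hfm hfdep hMf hδf hgm
    hgdep hMg hδg ℓ hℓ0 hℓ
  simpa using h

/-- **Exponential clustering for a finite-range potential** (Föllmer 1988, Ch. I, (2.23)–(2.24)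
with Remark (2.17); Künsch 1982; Georgii 2011, Rem. 8.26): with Simon's linear coefficients and a
nonnegative "distance increment" `d x y` along `nbr` whose WEIGHTED row sums satisfy
`∑_{y ∈ nbr x} |β| D x y · e^{t d x y} ≤ c < 1`, every Gibbs measure `μ` of
`gibbsSpecOfSummablePotential ν Φ β` satisfies
`|cov_μ(f, g)| ≤ 2 (∑ δg) (∑ δf) e^{−t m}` whenever a profile `ρ ≤ 0` on `Δ_g`, `ρ x ≤ ρ y + d x y`
along `nbr`, has `ρ ≥ m` on `Δ_f` (e.g. `ρ` = graph distance to `Δ_g`, `m` = the distance between the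
supports) — the tree's `DobrushinMetric.abs_covariance_le_of_isKRContraction_exp_dist` fed with
`isKRContraction_gibbsSpecOfSummablePotential` (weight `r ≡ 1`, `R = 1`).
[cite: Follmer1988, Ch. I (2.23)–(2.24)] -/
theorem abs_covariance_le_of_finiteRange_exp_dist [Countable V] [MeasurableSingletonClass S]
    (ν : Measure S) [IsProbabilityMeasure ν] (hΦ : Φ.IsAdapted) (hb : Φ.HasSummableBound b)
    (β : ℝ) (hnot : ∀ x, x ∉ nbr x)
    (hrange : ∀ B : Finset V, b B ≠ 0 → ∀ x ∈ B, ∀ z ∈ B, z ≠ x → z ∈ nbr x)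
    {μ : Measure (V → S)} (hμ : IsGibbsMeasure (gibbsSpecOfSummablePotential ν Φ β) μ)
    {f g : (V → S) → ℝ} (hfm : Measurable f) {Δf : Finset V} (hfdep : DependsOn f (↑Δf : Set V))
    {Mf : ℝ} (hMf : ∀ σ, |f σ| ≤ Mf) {δf : V → ℝ}
    (hδf : DobrushinMetric.IsLipBound (fun _ _ => (1 : ℝ)) f δf)
    (hgm : Measurable g) {Δg : Finset V} (hgdep : DependsOn g (↑Δg : Set V)) {Mg : ℝ}
    (hMg : ∀ σ, |g σ| ≤ Mg) {δg : V → ℝ} (hδg : DobrushinMetric.IsLipBound (fun _ _ => (1 : ℝ)) g δg)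
    {c : ℝ} (hc0 : 0 ≤ c) (hc1 : c < 1) (d : V → V → ℝ) (hd : ∀ x ∉ Δg, ∀ y ∈ nbr x, 0 ≤ d x y)
    {t : ℝ} (ht : 0 ≤ t)
    (hroww : ∀ x ∉ Δg, ∑ y ∈ nbr x,
      |β| * (∑' B : Finset V, if x ∈ B ∧ y ∈ B then b B else 0) * Real.exp (t * d x y) ≤ c)
    (ρ : V → ℝ) (hρg : ∀ y ∈ Δg, ρ y ≤ 0) (hρ : ∀ x ∉ Δg, ∀ y ∈ nbr x, ρ x ≤ ρ y + d x y)
    {m : ℝ} (hm : ∀ y ∈ Δf, m ≤ ρ y) :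
    |ProbabilityTheory.covariance f g μ| ≤
      2 * (∑ y ∈ Δg, δg y) * (∑ y ∈ Δf, δf y) * Real.exp (-(t * m)) := by
  have h := DobrushinMetric.abs_covariance_le_of_isKRContraction_exp_dist
    (isSpecification_gibbsSpecOfSummablePotential ν hΦ hb β)
    (isKRContraction_gibbsSpecOfSummablePotential ν hΦ hb β hnot hrange) (R := 1)
    (fun _ _ => zero_le_one) (fun _ _ => le_rfl) zero_le_one hμ hfm hfdep hMf hδf hgm hgdep hMg
    hδg hc0 hc1 d hd ht hroww ρ hρg hρ hm
  simpa using h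

end FiniteRange

/-! ### The same constructor in `gibbsSpecOfPotential` form (finitely supported potentials)

For a potential with `Φ_B = 0` off a finite family `T`, `|Φ_B| ≤ C B`, supported by the
volume-wise families `supp` (`Potential.IsSupportedBy`), the tree's PRIMARY finite-range
specification `gibbsSpecOfPotential ν Φ supp β` coincides with `gibbsSpecOfSummablePotential ν Φ β`
(`gibbsSpecOfSummablePotential_eq_gibbsSpecOfPotential`) and `Potential.hasSummableBound_of_finite`
supplies the majorant; the following corollaries restate the constructor, the row sums (6.47) and
the exponential clustering with the FINITE pair sums `∑_{B ∈ T, B ∋ x, y} C B`, so that users of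
`gibbsSpecOfPotential` (lattice gauge / constrained specifications) need no re-expression step. -/

section FinitelySupported

variable {Φ : Potential V S} {C : Finset V → ℝ} {T : Finset (Finset V)}
  {supp : Finset V → Finset (Finset V)} {nbr : V → Finset V}

omit [MeasurableSpace S] in
/-- The pair bound of the majorant `1_T · C` is the finite pair sum over `T`.
[cite: FriedliVelenik2017, eq. (6.46)] -/
theorem pairBound_indicator_eq_sum (x y : V) :
    (∑' B : Finset V, if x ∈ B ∧ y ∈ B then (if B ∈ T then C B else 0) else 0) =
      ∑ B ∈ T, if x ∈ B ∧ y ∈ B then C B else 0 := by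
  rw [pairBound_eq_sum (b := fun B => if B ∈ T then C B else 0) (fun B hB => if_neg hB)]
  exact Finset.sum_congr rfl fun B hB => by rw [if_pos hB]

omit [MeasurableSpace S] in
/-- Range hypothesis transfer: a neighbourhood covering every `B ∈ T` through each of its sites
covers the support of the majorant `1_T · C` (plumbing). [folklore] -/
private theorem range_of_indicator
    (hrange : ∀ B ∈ T, ∀ x ∈ B, ∀ z ∈ B, z ≠ x → z ∈ nbr x) :
    ∀ B : Finset V, (if B ∈ T then C B else 0) ≠ 0 → ∀ x ∈ B, ∀ z ∈ B, z ≠ x → z ∈ nbr x := by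
  intro B hB
  by_cases hBT : B ∈ T
  · exact hrange B hBT
  · exact absurd (if_neg hBT) hB

/-- **Dobrushin's condition in Simon's linear form, `gibbsSpecOfPotential` version** (Simon 1979,
Theorem with the Lemma p. 184; Friedli–Velenik 2017, Thm. 6.35 / (6.46); Georgii 2011, Prop. 8.8
with (2.11)): for an adapted potential with `|Φ_B| ≤ C B`, `Φ_B = 0` off the finite family `T`,
supported by `supp`, and a neighbourhood `nbr x ∌ x` covering every `B ∈ T` through `x`,
`IsKRContraction (gibbsSpecOfPotential ν Φ supp β) 1 nbr C'` with
`C' x y = |β| ∑_{B ∈ T, B ∋ x, y} C B`. [cite: FriedliVelenik2017, Thm. 6.35] -/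
theorem isKRContraction_gibbsSpecOfPotential [Countable V] (ν : Measure S)
    [IsProbabilityMeasure ν] (hΦ : Φ.IsAdapted) (hC : ∀ B σ, |Φ B σ| ≤ C B)
    (hT : ∀ B ∉ T, Φ B = 0) (hsupp : Φ.IsSupportedBy supp) (β : ℝ)
    (hnot : ∀ x, x ∉ nbr x) (hrange : ∀ B ∈ T, ∀ x ∈ B, ∀ z ∈ B, z ≠ x → z ∈ nbr x) :
    DobrushinMetric.IsKRContraction (gibbsSpecOfPotential ν Φ supp β) (fun _ _ => (1 : ℝ)) nbr
      fun x y => |β| * ∑ B ∈ T, if x ∈ B ∧ y ∈ B then C B else 0 := by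
  have h := isKRContraction_gibbsSpecOfSummablePotential ν hΦ
    (Potential.hasSummableBound_of_finite hC hT) β hnot (range_of_indicator hrange)
  rw [gibbsSpecOfSummablePotential_eq_gibbsSpecOfPotential ν hsupp β] at h
  convert h using 3 with x y
  rw [pairBound_indicator_eq_sum]

omit [MeasurableSpace S] in
/-- **Row sums (Friedli–Velenik (6.47)) for the finite pair sums**:
`∑_{y ∈ nbr x} ∑_{B ∈ T, B ∋ x, y} C B = ∑_{B ∈ T, B ∋ x} (|B| − 1) C B`; hence Dobrushin's constant
of `gibbsSpecOfPotential ν Φ supp β` in Simon's form is `|β| sup_x ∑_{B ∈ T, B ∋ x} (|B| − 1) C B`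
(Friedli–Velenik 2017, Cor. 6.37; Simon 1979, Theorem). [cite: FriedliVelenik2017, eq. (6.47)] -/
theorem sum_nbr_pairSum_eq (hnot : ∀ x, x ∉ nbr x)
    (hrange : ∀ B ∈ T, ∀ x ∈ B, ∀ z ∈ B, z ≠ x → z ∈ nbr x) (x : V) :
    ∑ y ∈ nbr x, (∑ B ∈ T, if x ∈ B ∧ y ∈ B then C B else 0) =
      ∑ B ∈ T, if x ∈ B then ((B.card : ℝ) - 1) * C B else 0 :=
  calc ∑ y ∈ nbr x, (∑ B ∈ T, if x ∈ B ∧ y ∈ B then C B else 0)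
      = ∑ y ∈ nbr x,
          (∑' B : Finset V, if x ∈ B ∧ y ∈ B then (if B ∈ T then C B else 0) else 0) :=
        Finset.sum_congr rfl fun y _ => (pairBound_indicator_eq_sum x y).symm
    _ = ∑ B ∈ T, if x ∈ B then ((B.card : ℝ) - 1) * (if B ∈ T then C B else 0) else 0 :=
        sum_nbr_pairBound_eq (fun B hB => if_neg hB) hnot (range_of_indicator hrange) x
    _ = ∑ B ∈ T, if x ∈ B then ((B.card : ℝ) - 1) * C B else 0 :=
        Finset.sum_congr rfl fun B hB => by rw [if_pos hB]

/-- **Exponential clustering for a finitely supported potential, `gibbsSpecOfPotential` version**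
(Föllmer 1988, Ch. I, (2.23)–(2.24) with Remark (2.17); Künsch 1982; Georgii 2011, Rem. 8.26):
`abs_covariance_le_of_finiteRange_exp_dist` transported along
`gibbsSpecOfSummablePotential_eq_gibbsSpecOfPotential`, with the weighted row-sum hypothesis on the
finite pair sums `|β| ∑_{B ∈ T, B ∋ x, y} C B`. [cite: Follmer1988, Ch. I (2.23)–(2.24)] -/
theorem abs_covariance_le_of_finSupp_exp_dist [Countable V] [MeasurableSingletonClass S]
    (ν : Measure S) [IsProbabilityMeasure ν] (hΦ : Φ.IsAdapted) (hC : ∀ B σ, |Φ B σ| ≤ C B)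
    (hT : ∀ B ∉ T, Φ B = 0) (hsupp : Φ.IsSupportedBy supp) (β : ℝ) (hnot : ∀ x, x ∉ nbr x)
    (hrange : ∀ B ∈ T, ∀ x ∈ B, ∀ z ∈ B, z ≠ x → z ∈ nbr x)
    {μ : Measure (V → S)} (hμ : IsGibbsMeasure (gibbsSpecOfPotential ν Φ supp β) μ)
    {f g : (V → S) → ℝ} (hfm : Measurable f) {Δf : Finset V} (hfdep : DependsOn f (↑Δf : Set V))
    {Mf : ℝ} (hMf : ∀ σ, |f σ| ≤ Mf) {δf : V → ℝ}
    (hδf : DobrushinMetric.IsLipBound (fun _ _ => (1 : ℝ)) f δf)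
    (hgm : Measurable g) {Δg : Finset V} (hgdep : DependsOn g (↑Δg : Set V)) {Mg : ℝ}
    (hMg : ∀ σ, |g σ| ≤ Mg) {δg : V → ℝ} (hδg : DobrushinMetric.IsLipBound (fun _ _ => (1 : ℝ)) g δg)
    {c : ℝ} (hc0 : 0 ≤ c) (hc1 : c < 1) (d : V → V → ℝ) (hd : ∀ x ∉ Δg, ∀ y ∈ nbr x, 0 ≤ d x y)
    {t : ℝ} (ht : 0 ≤ t)
    (hroww : ∀ x ∉ Δg, ∑ y ∈ nbr x,
      |β| * (∑ B ∈ T, if x ∈ B ∧ y ∈ B then C B else 0) * Real.exp (t * d x y) ≤ c)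
    (ρ : V → ℝ) (hρg : ∀ y ∈ Δg, ρ y ≤ 0) (hρ : ∀ x ∉ Δg, ∀ y ∈ nbr x, ρ x ≤ ρ y + d x y)
    {m : ℝ} (hm : ∀ y ∈ Δf, m ≤ ρ y) :
    |ProbabilityTheory.covariance f g μ| ≤
      2 * (∑ y ∈ Δg, δg y) * (∑ y ∈ Δf, δf y) * Real.exp (-(t * m)) := by
  rw [← gibbsSpecOfSummablePotential_eq_gibbsSpecOfPotential ν hsupp β] at hμ
  refine abs_covariance_le_of_finiteRange_exp_dist ν hΦ (Potential.hasSummableBound_of_finite hC hT)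
    β hnot (range_of_indicator hrange) hμ hfm hfdep hMf hδf hgm hgdep hMg hδg hc0 hc1 d hd ht
    (fun x hx => ?_) ρ hρg hρ hm
  have hy : ∀ y,
      |β| * (∑' B : Finset V, if x ∈ B ∧ y ∈ B then (if B ∈ T then C B else 0) else 0) *
          Real.exp (t * d x y) =
        |β| * (∑ B ∈ T, if x ∈ B ∧ y ∈ B then C B else 0) * Real.exp (t * d x y) := fun y => by
    rw [pairBound_indicator_eq_sum]
  rw [Finset.sum_congr rfl fun y _ => hy y]
  exact hroww x hx

/-- **Simon's uniqueness theorem for a finitely supported potential, `gibbsSpecOfPotential`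
version** (Simon 1979, Theorem p. 184; Friedli–Velenik 2017, Cor. 6.37 with (6.47); Georgii 2011,
Prop. 8.8 with Thm. 8.7): on a spin space of diameter `≤ A`, if
`|β| ∑_{B ∈ T, B ∋ x} (|B| − 1) C B ≤ c < 1` for every site `x`, then `gibbsSpecOfPotential ν Φ supp β`
admits at most one Gibbs measure — the companion file's
`subsingleton_gibbsMeasures_gibbsSpecOfSummablePotential_simon` transported along
`gibbsSpecOfSummablePotential_eq_gibbsSpecOfPotential`. [cite: FriedliVelenik2017, Cor. 6.37] -/
theorem subsingleton_gibbsMeasures_gibbsSpecOfPotential_simon [Countable V]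
    [MeasurableSingletonClass S] [PseudoMetricSpace S] [BorelSpace S] [Nonempty S]
    (ν : Measure S) [IsProbabilityMeasure ν] (hΦ : Φ.IsAdapted) (hC : ∀ B σ, |Φ B σ| ≤ C B)
    (hT : ∀ B ∉ T, Φ B = 0) (hsupp : Φ.IsSupportedBy supp) (β : ℝ) {A : ℝ} (hA0 : 0 ≤ A)
    (hA : ∀ a c : S, dist a c ≤ A) {c : ℝ} (hc0 : 0 ≤ c) (hc1 : c < 1)
    (hrow : ∀ x, |β| * ∑ B ∈ T, (if x ∈ B then ((B.card : ℝ) - 1) * C B else 0) ≤ c) :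
    (gibbsMeasures (gibbsSpecOfPotential ν Φ supp β)).Subsingleton := by
  rw [← gibbsSpecOfSummablePotential_eq_gibbsSpecOfPotential ν hsupp β]
  refine subsingleton_gibbsMeasures_gibbsSpecOfSummablePotential_simon ν hΦ
    (Potential.hasSummableBound_of_finite hC hT) β hA0 hA
    (fun x => ∑ B ∈ T, if x ∈ B then ((B.card : ℝ) - 1) * C B else 0) (fun x => ?_) hc0 hc1 hrow
  have h : HasSum
      (fun B : Finset V => if x ∈ B then ((B.card : ℝ) - 1) * (if B ∈ T then C B else 0) else 0)
      (∑ B ∈ T, if x ∈ B then ((B.card : ℝ) - 1) * (if B ∈ T then C B else 0) else 0) :=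
    hasSum_sum_of_ne_finset_zero fun B hB => by simp [hB]
  convert h using 2 with B hB
  rw [if_pos hB]

end FinitelySupported

end Literature.Probability.LatticeModels

end
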